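import Literature.AlgebraicGeometry.HodgeTheory.WeilClassesRationalPlane
import Literature.AlgebraicGeometry.HodgeTheory.HodgeTypeConjugation
import Literature.AlgebraicGeometry.HodgeTheory.ComplexConjugationHolds
import Literature.AlgebraicGeometry.HodgeTheory.HodgeSectionRestrictionPairing
import Literature.AlgebraicGeometry.HodgeTheory.HodgeRiemannPolarizabilityProofs
import Literature.AlgebraicGeometry.HodgeTheory.HardLefschetzNFold
import HarnessLib

/-!
# Route AmpleAdicLefschetz — crux `ThickDescent` (stmt-HodgeConjecture-2613), stub
# `stub_anisotropicKernel`: the anisotropy step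

For a morphism `f : Y ⟶ X` of smooth projective complex varieties (`dim X = n`,
`dim Y = m = 2p + s`, `2p + k = 2m`) and a class `κ ∈ H²(X(ℂ); ℂ)` whose restriction `f^* κ` is
RATIONAL, write `L = f^* κ ∪ ·` on `H^*(Y(ℂ); ℂ)`. Assume the sign-free Hodge–Riemann anisotropy
of `L` on the rational primitive `(p,p)`-classes of `Y` (a HYPOTHESIS of the stub: for `y`
rational of type `(p,p)` with `L^{s+1} y = 0` and `y ≠ 0`, `Lˢ y ∪ y ≠ 0` in `H^{2m}(Y(ℂ); ℂ)`;
C. Voisin, *Hodge Theory and Complex Algebraic Geometry I* (2002), §6.3.2 Thm. 6.32, the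
Lefschetz decomposition being defined over `ℚ`, §7.1.2). THEN a class `x ∈ H²ᵖ(X(ℂ); ℂ)` whose
restriction `x' = f^* x` (i) lies in the complex span of the rational `(p,p)`-classes of `Y`,
(ii) is primitive (`L^{s+1} x' = 0`) and (iii) satisfies `x' ∪ f^* y = 0` for every
`y ∈ Hᵏ(X(ℂ); ℂ)`, has `x' = 0`.

The proof is rational linear algebra on the tree's carriers (`complexBetti`, `IsRationalClass`,
`IsOfHodgeType`, the Alexander–Whitney `cupProduct` and its Lefschetz iterates `lefschetzPowTo`),
by the FUNCTIONAL TRICK of `SupportedClassesRational` / `WeilClassesRationalPlane` (a complex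
relation among rational classes yields all its images under the `ℚ`-linear functionals
`φ : ℂ → ℚ`, Hatcher §3.1 p. 198), used three times:

* `complexBetti_map_mem_span_primitive_restricted` — `x'` lies in the complex span of the
  rational, `(p,p)`, primitive, RESTRICTED (`= f^* u`) classes: expand `x` over rational classes of
  `X` (`span_isRationalClass_eq_top_of_isSmoothProjective_holds`) and `x'` over rational
  `(p,p)`-classes of `Y`; the shadows `Σ_j φ(g_j) b_j` of `x' = Σ_j g_j b_j` are restricted
  (`sum_dual_smul_eq_zero_of_isRationalClass` on the difference of the two expansions), primitive
  (`apply_sum_dual_smul_eq_zero` for `L^{s+1}`, which preserves rationality since `f^* κ` is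
  rational), and span `x'` (`sum_smul_mem_span_dual`).
* `sum_smul_eq_zero_of_forall_apply_eq_zero` — pure linear algebra: a complex combination
  `w = Σ_l t_l r_l` of vectors of a `ℚ`-stable class `P` on which a bilinear form `Q` is
  rational-valued and anisotropic, with `Q(w, r_l) = 0` for all `l`, vanishes (the shadows
  `Σ_l φ(t_l) r_l` are `Q`-orthogonal to every `r_l`, hence isotropic, hence zero). This replaces
  the invertibility of the complexified Gram matrix of an anisotropic rational form.
* the stub: `Q(u, v) = λ_ℂ(Lˢ u ∪ v)` with `λ_ℂ = cTopCoord hY` the coordinate of the line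
  `H^{2m}(Y(ℂ); ℂ)` (rational on rational classes, `cTopCoord_ofRatClass`; one-to-one,
  `cTopCoord_smul_self`), `P` = rational ∧ `(p,p)` ∧ primitive, anisotropy = `hHR`, and
  `Q(x', f^* u) = λ_ℂ(x' ∪ Lˢ f^* u) = λ_ℂ(x' ∪ f^* Lˢ u) = 0` by (iii)
  (`cupProduct_lefschetzPowTo_left/right`, `lefschetzPow_map`).

No named fact is introduced; nothing unproved is used.

## References

* [VoisinHodgeI2002] C. Voisin, Hodge Theory and Complex Algebraic Geometry I, CUP 2002, §6.2.3,
  §6.3.2 Thm. 6.32, §7.1.1, §7.1.2.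
* [HatcherAT2002] A. Hatcher, Algebraic Topology, CUP 2002, §3.1 p. 198, §3.2 Prop. 3.10, p. 211,
  Thm. 3.11.
-/

noncomputable section

-- every declaration of this problem lives in `Summit.HodgeConjecture.HodgeConjecture.…`
-- (summit = sub-problem): the duplicate namespace component is mandated
set_option linter.dupNamespace false

namespace Summit.HodgeConjecture.HodgeConjecture.Theorems

open CategoryTheory AlgebraicGeometry
open Literature.AlgebraicGeometry Literature.AlgebraicGeometry.Motives
open Literature.AlgebraicGeometry.HodgeTheory
open Literature.AlgebraicTopology.SingularHomology Literature.Geometry.Kaehler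

/-! ### Linear algebra: the functional trick against an anisotropic rational form -/

section LinearAlgebra

variable {V : Type*} [AddCommGroup V] [Module ℂ V]

/-- `Q u (Σ c_l r_l) = Σ c_l Q u r_l` for a bilinear form `Q`. [folklore] -/
private theorem bilin_apply_sum_smul (Q : V →ₗ[ℂ] V →ₗ[ℂ] ℂ) (u : V) {ι : Type*} (s : Finset ι)
    (c : ι → ℂ) (r : ι → V) : Q u (∑ l ∈ s, c l • r l) = ∑ l ∈ s, c l * Q u (r l) := by
  rw [map_sum]
  exact Finset.sum_congr rfl fun l _ ↦ by rw [map_smul, smul_eq_mul]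

/-- `Q (Σ c_l r_l) v = Σ c_l Q r_l v` for a bilinear form `Q`. [folklore] -/
private theorem bilin_sum_smul_apply (Q : V →ₗ[ℂ] V →ₗ[ℂ] ℂ) {ι : Type*} (s : Finset ι)
    (c : ι → ℂ) (r : ι → V) (v : V) : Q (∑ l ∈ s, c l • r l) v = ∑ l ∈ s, c l * Q (r l) v := by
  rw [map_sum, LinearMap.sum_apply]
  exact Finset.sum_congr rfl fun l _ ↦ by rw [map_smul, LinearMap.smul_apply, smul_eq_mul]

/-- **The functional trick against an anisotropic rational form.** Let `Q` be a complex bilinear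
form on `V` and `P` a class of vectors closed under finite RATIONAL linear combinations, on which
`Q` takes rational values and is ANISOTROPIC (`P v`, `Q v v = 0 ⇒ v = 0`). If a complex combination
`w = Σ_l t_l r_l` of vectors `r_l` in `P` is `Q`-orthogonal to every `r_l`, then `w = 0`. Proof: the
complex relation `Σ_l t_l Q(r_l, r_{l'}) = 0` has rational coefficients `Q(r_l, r_{l'})`, so every
`ℚ`-linear `φ : ℂ → ℚ` yields `Σ_l φ(t_l) Q(r_l, r_{l'}) = 0`, i.e. the rational shadow
`r_φ = Σ_l φ(t_l) r_l` (again in `P`) is orthogonal to every `r_{l'}`, hence isotropic, hence zero;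
and `w` is a complex combination of its shadows (`sum_smul_mem_span_dual`). This replaces the
invertibility of the Gram matrix of an anisotropic rational form after complexification.
[folklore] -/
private theorem sum_smul_eq_zero_of_forall_apply_eq_zero (Q : V →ₗ[ℂ] V →ₗ[ℂ] ℂ) (P : V → Prop)
    (hP : ∀ (N : ℕ) (q : Fin N → ℚ) (r : Fin N → V), (∀ l, P (r l)) →
      P (∑ l, ((q l : ℚ) : ℂ) • r l))
    (hQ : ∀ u v, P u → P v → ∃ a : ℚ, Q u v = a)
    (han : ∀ v, P v → Q v v = 0 → v = 0)
    {N : ℕ} {r : Fin N → V} (hr : ∀ l, P (r l)) (t : Fin N → ℂ)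
    (horth : ∀ l', Q (∑ l, t l • r l) (r l') = 0) :
    ∑ l, t l • r l = 0 := by
  choose G hG using fun l l' ↦ hQ (r l) (r l') (hr l) (hr l')
  -- (a) every rational shadow `r_φ = Σ_l φ(t_l) r_l` is orthogonal to every `r l'`
  have hshadow : ∀ (φ : ℂ →ₗ[ℚ] ℚ) (l' : Fin N),
      Q (∑ l, ((φ (t l) : ℚ) : ℂ) • r l) (r l') = 0 := by
    intro φ l'
    -- the complex relation `Σ_l t_l G_{l l'} = 0` with rational `G`
    have h1 : ∑ l, t l * (G l l' : ℂ) = 0 :=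
      calc ∑ l, t l * (G l l' : ℂ) = ∑ l, t l * Q (r l) (r l') :=
            Finset.sum_congr rfl fun l _ ↦ by rw [hG]
        _ = Q (∑ l, t l • r l) (r l') := (bilin_sum_smul_apply Q _ t r (r l')).symm
        _ = 0 := horth l'
    -- its image under `φ`
    have h2 : ∑ l, φ (t l) * G l l' = 0 := by
      have h3 : φ (∑ l, t l * (G l l' : ℂ)) = 0 := by rw [h1, map_zero]
      rw [map_sum] at h3
      rw [← h3]
      refine Finset.sum_congr rfl fun l _ ↦ ?_
      rw [show t l * (G l l' : ℂ) = (G l l') • t l by rw [Rat.smul_def, mul_comm], map_smul,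
        smul_eq_mul, mul_comm]
    rw [bilin_sum_smul_apply]
    calc ∑ l, ((φ (t l) : ℚ) : ℂ) * Q (r l) (r l')
        = ∑ l, (((φ (t l) * G l l' : ℚ)) : ℂ) :=
          Finset.sum_congr rfl fun l _ ↦ by rw [hG, Rat.cast_mul]
      _ = 0 := by rw [← Rat.cast_sum, h2, Rat.cast_zero]
  -- (b) hence every shadow is isotropic, hence zero
  have hzero : ∀ φ : ℂ →ₗ[ℚ] ℚ, ∑ l, ((φ (t l) : ℚ) : ℂ) • r l = 0 := by
    intro φ
    refine han _ (hP N _ r hr) ?_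
    rw [bilin_apply_sum_smul]
    exact Finset.sum_eq_zero fun l' _ ↦ by rw [hshadow φ l', mul_zero]
  -- (c) `Σ_l t_l r_l` is a complex combination of its shadows
  have hbot : Submodule.span ℂ
      {x : V | ∃ φ : ℂ →ₗ[ℚ] ℚ, x = ∑ j, ((φ (t j) : ℚ) : ℂ) • r j} = ⊥ :=
    Submodule.span_eq_bot.2 (by rintro _ ⟨φ, rfl⟩; exact hzero φ)
  have hmem := sum_smul_mem_span_dual t r
  rw [hbot, Submodule.mem_bot] at hmem
  exact hmem

end LinearAlgebra

/-! ### Cup-product bookkeeping on the complex cohomology of `Y` -/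

section Concrete

variable {X Y : SchemeOver ℂ}

/-- **Naturality of the Lefschetz iterates**: `f^* (Lʲ_κ u) = Lʲ_{f^* κ} (f^* u)` (explicit target
degree; `lefschetzPow_map`, i.e. `f^*(a ∪ b) = f^* a ∪ f^* b`).
[cite: HatcherAT2002, §3.2 Prop. 3.10] -/
private theorem complexBetti_map_lefschetzPowTo (f : Y ⟶ X) (κ : complexBetti X 2) (j a b : ℕ)
    (h : a + 2 * j = b) (u : complexBetti X a) :
    complexBetti.map f b (lefschetzPowTo κ j a b h u) =
      lefschetzPowTo (complexBetti.map f 2 κ) j a b h (complexBetti.map f a u) := by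
  subst h
  exact lefschetzPow_map (AlgPoints.mapContinuous (L := ℂ) f) κ j a u

/-- `(Lˢ u) ∪ v = u ∪ (Lˢ v)` for `u, v ∈ H²ᵖ(Y(ℂ); ℂ)`, with the two degree spellings
`2p + 2s + 2p = 2m` and `2p + k = 2m`, `k = 2p + 2s` (all powers of `κ` may be moved onto either
factor: associativity and graded commutativity of the cup product, `κ` of even degree).
[cite: HatcherAT2002, §3.2 p. 211 and Thm. 3.11] -/
private theorem cupProduct_lefschetzPowTo_comm {p s m k : ℕ} (κ : complexBetti Y 2)
    (h2m : 2 * p + 2 * s + 2 * p = 2 * m) (hk2 : 2 * p + 2 * s = k) (hk : 2 * p + k = 2 * m)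
    (u v : complexBetti Y (2 * p)) :
    cupProduct h2m (lefschetzPowTo κ s (2 * p) (2 * p + 2 * s) rfl u) v =
      cupProduct hk u (lefschetzPowTo κ s (2 * p) k hk2 v) := by
  rw [cupProduct_lefschetzPowTo_left κ s rfl h2m rfl (by omega) u v,
    cupProduct_lefschetzPowTo_right κ s hk2 hk rfl (by omega) u v]

/-- **Restricted classes are `Lˢ`-orthogonal to a class orthogonal to `f^* Hᵏ(X(ℂ))`**: if
`x' ∪ f^* y = 0` for every `y ∈ Hᵏ(X(ℂ); ℂ)` (`k = 2p + 2s`), then `Lˢ x' ∪ f^* u = 0` for every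
`u ∈ H²ᵖ(X(ℂ); ℂ)`, since `Lˢ x' ∪ f^* u = x' ∪ Lˢ (f^* u) = x' ∪ f^* (Lˢ u)`.
[cite: HatcherAT2002, §3.2 Prop. 3.10 and p. 211] -/
private theorem cupProduct_lefschetzPowTo_map_eq_zero {p s m k : ℕ} (f : Y ⟶ X)
    (κ : complexBetti X 2) (h2m : 2 * p + 2 * s + 2 * p = 2 * m) (hk : 2 * p + k = 2 * m)
    (hk2 : 2 * p + 2 * s = k)
    (x' : complexBetti Y (2 * p))
    (horth : ∀ y : complexBetti X k, cupProduct hk x' (complexBetti.map f k y) = 0)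
    (u : complexBetti X (2 * p)) :
    cupProduct h2m (lefschetzPowTo (complexBetti.map f 2 κ) s (2 * p) (2 * p + 2 * s) rfl x')
      (complexBetti.map f (2 * p) u) = 0 := by
  rw [cupProduct_lefschetzPowTo_comm _ h2m hk2 hk, ← complexBetti_map_lefschetzPowTo]
  exact horth _

/-- The complex coordinate of the line `H^{2m}(Y(ℂ); ℂ)` is one-to-one: `λ_ℂ(z) = 0 ⇒ z = 0`
(`cTopCoord_smul_self`). [folklore] -/
private theorem eq_zero_of_cTopCoord_eq_zero {m : ℕ} (hY : IsSmoothProjective m Y)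
    {z : complexBetti Y (2 * m)} (hz : cTopCoord hY z = 0) : z = 0 := by
  rw [← cTopCoord_smul_self hY z, hz, zero_smul]

/-- The complex coordinate of a RATIONAL top class is a rational number
(`cTopCoord_ofRatClass`: `λ_ℂ(z ⊗ 1) = λ_ℚ(z)`). [cite: HatcherAT2002, §3.1 p. 198] -/
private theorem exists_cTopCoord_eq_ratCast {m : ℕ} (hY : IsSmoothProjective m Y)
    {z : complexBetti Y (2 * m)} (hz : IsRationalClass z) : ∃ a : ℚ, cTopCoord hY z = a := by
  obtain ⟨w, rfl⟩ := (isRationalClass_iff_mem_range_ofRatClass z).1 hz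
  exact ⟨ratTopCoord hY w, by rw [cTopCoord_ofRatClass, eq_ratCast]⟩

/-- **The restriction `f^* x` lies in the complex span of the rational, `(p,p)`, PRIMITIVE,
RESTRICTED classes** as soon as it lies in the span of the rational `(p,p)`-classes and is
primitive (`L^{s+1} f^* x = 0`, `L = f^* κ ∪ ·` with `f^* κ` rational). The functional trick: write
`x = Σ_i h_i u_i` over rational classes of `X` (they span, Voisin I §7.1.1) and
`f^* x = Σ_j g_j b_j` over rational `(p,p)`-classes of `Y`; the single complex relation
`Σ_i h_i f^* u_i - Σ_j g_j b_j = 0` among rational classes gives, for every `ℚ`-linear `φ : ℂ → ℚ`,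
`Σ_j φ(g_j) b_j = f^* (Σ_i φ(h_i) u_i)` (`sum_dual_smul_eq_zero_of_isRationalClass`), a rational
`(p,p)` restricted class, primitive by the same trick applied to `L^{s+1}`
(`apply_sum_dual_smul_eq_zero`); and `f^* x` is a complex combination of these shadows
(`sum_smul_mem_span_dual`). [cite: VoisinHodgeI2002, §7.1.1 and §7.1.2]
[cite: HatcherAT2002, §3.1 p. 198] -/
private theorem complexBetti_map_mem_span_primitive_restricted {n m p s : ℕ} (f : Y ⟶ X)
    (hX : IsSmoothProjective n X) (hY : IsSmoothProjective m Y) (A : HodgeModel m Y)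
    (κ : complexBetti X 2) (hκ : IsRationalClass (complexBetti.map f 2 κ))
    (x : complexBetti X (2 * p))
    (hxspan : complexBetti.map f (2 * p) x ∈ Submodule.span ℂ
      {r : complexBetti Y (2 * p) | IsRationalClass r ∧ IsOfHodgeType m Y (2 * p) p p r})
    (hprim : lefschetzPowTo (complexBetti.map f 2 κ) (s + 1) (2 * p) (2 * p + 2 * (s + 1)) rfl
      (complexBetti.map f (2 * p) x) = 0) :
    complexBetti.map f (2 * p) x ∈ Submodule.span ℂ
      {r : complexBetti Y (2 * p) | (IsRationalClass r ∧ IsOfHodgeType m Y (2 * p) p p r ∧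
        lefschetzPowTo (complexBetti.map f 2 κ) (s + 1) (2 * p) (2 * p + 2 * (s + 1)) rfl r = 0) ∧
        ∃ u : complexBetti X (2 * p), complexBetti.map f (2 * p) u = r} := by
  classical
  obtain ⟨N₁, h, u', hx⟩ := Submodule.mem_span_set'.1
    (span_isRationalClass_eq_top_of_isSmoothProjective_holds.mem_span hX x)
  obtain ⟨N₂, g, b', hx'⟩ := Submodule.mem_span_set'.1 hxspan
  have hb : ∀ j, IsRationalClass (b' j : complexBetti Y (2 * p)) := fun j ↦ (b' j).2.1
  -- the rational family on the sum index type and the single complex relation among it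
  let c : Fin N₁ ⊕ Fin N₂ → complexBetti Y (2 * p) :=
    Sum.elim (fun i ↦ complexBetti.map f (2 * p) (u' i : complexBetti X (2 * p)))
      (fun j ↦ (b' j : complexBetti Y (2 * p)))
  let e : Fin N₁ ⊕ Fin N₂ → ℂ := Sum.elim h (fun j ↦ -g j)
  have hc : ∀ i, IsRationalClass (c i) := by
    rintro (i | j)
    · exact isRationalClass_complexBetti_map f (u' i).2
    · exact hb j
  have hfx : ∀ a : Fin N₁ → ℂ,
      complexBetti.map f (2 * p) (∑ i, a i • (u' i : complexBetti X (2 * p))) =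
        ∑ i, a i • complexBetti.map f (2 * p) (u' i : complexBetti X (2 * p)) := fun a ↦ by
    rw [map_sum]
    exact Finset.sum_congr rfl fun i _ ↦ map_smul _ _ _
  have hrel : ∑ i, e i • c i = 0 := by
    rw [Fintype.sum_sum_type]
    simp only [c, e, Sum.elim_inl, Sum.elim_inr, neg_smul, Finset.sum_neg_distrib]
    rw [← hfx h, hx, hx', add_neg_cancel]
  -- `f^* x = Σ_j g_j b_j` is a complex combination of the rational shadows `Σ_j φ(g_j) b_j`
  rw [← hx']
  refine Submodule.span_mono ?_ (sum_smul_mem_span_dual g fun j ↦ (b' j : complexBetti Y (2 * p)))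
  rintro _ ⟨φ, rfl⟩
  have hφ := sum_dual_smul_eq_zero_of_isRationalClass hc hrel φ
  rw [Fintype.sum_sum_type] at hφ
  simp only [c, e, Sum.elim_inl, Sum.elim_inr, map_neg, Rat.cast_neg, neg_smul,
    Finset.sum_neg_distrib] at hφ
  simp only [Set.mem_setOf_eq]
  refine ⟨⟨IsRationalClass.sum_smul _ hb _, ?_, ?_⟩,
    ∑ i, ((φ (h i) : ℚ) : ℂ) • (u' i : complexBetti X (2 * p)), ?_⟩
  · exact IsOfHodgeType.sum hY A _ _ fun j _ ↦ (b' j).2.2.smul _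
  · exact apply_sum_dual_smul_eq_zero _ (fun c hc ↦ hκ.lefschetzPowTo _ _ _ rfl hc) hb
      (by rw [hx']; exact hprim) φ
  · rw [hfx]
    exact add_neg_eq_zero.1 hφ

end Concrete

/-! ### The stub -/

/-- **Stub `stub_anisotropicKernel` of the crux `ThickDescent`** — THE ANISOTROPY STEP. `X`, `Y`
smooth projective (`dim Y = m = 2p + s`, `2p + k = 2m`), `f : Y ⟶ X`, `κ ∈ H²(X(ℂ); ℂ)` with
`f^* κ` RATIONAL and satisfying the sign-free Hodge–Riemann anisotropy `hHR` on rational primitive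
`(p,p)`-classes of `Y` (for `y` rational of type `(p,p)` with `L^{s+1} y = 0`, `y ≠ 0`:
`Lˢ y ∪ y ≠ 0`; a HYPOTHESIS here). If `f^* x` lies in the `ℂ`-span of the rational
`(p,p)`-classes, is primitive, and `f^* x ∪ f^* y = 0` for all `y ∈ Hᵏ(X(ℂ); ℂ)`, then
`f^* x = 0`. Proof: by `complexBetti_map_mem_span_primitive_restricted`, `f^* x = Σ_l t_l r_l`
with `r_l` rational, `(p,p)`, primitive and RESTRICTED (`r_l = f^* u_l`); the form
`Q(u, v) = λ_ℂ(Lˢ u ∪ v)` (`λ_ℂ` the coordinate of the line `H^{2m}(Y(ℂ); ℂ)`) is rational on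
rational classes (`IsRationalClass.cup/.lefschetzPowTo`, `cTopCoord_ofRatClass`), anisotropic on
the rational primitive `(p,p)`-classes by `hHR`, and `Q(f^* x, r_l) = λ_ℂ(f^* x ∪ f^* Lˢ u_l) = 0`;
the functional trick `sum_smul_eq_zero_of_forall_apply_eq_zero` concludes.
[cite: VoisinHodgeI2002, §6.3.2 Thm. 6.32 and §7.1.2] [cite: HatcherAT2002, §3.1 p. 198] -/
theorem stub_anisotropicKernel :
    ∀ ⦃n m p s k : ℕ⦄ ⦃X Y : SchemeOver ℂ⦄ (f : Y ⟶ X) (hX : IsSmoothProjective n X)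
      (hY : IsSmoothProjective m Y) (hs : 2 * p + s = m) (hk : 2 * p + k = 2 * m)
      (κ : complexBetti X 2), IsRationalClass (complexBetti.map f 2 κ) →
      (∀ y : complexBetti Y (2 * p), IsRationalClass y → IsOfHodgeType m Y (2 * p) p p y →
        lefschetzPowTo (complexBetti.map f 2 κ) (s + 1) (2 * p) (2 * p + 2 * (s + 1)) rfl y = 0 →
        y ≠ 0 →
        cupProduct (show 2 * p + 2 * s + 2 * p = 2 * m by omega)
          (lefschetzPowTo (complexBetti.map f 2 κ) s (2 * p) (2 * p + 2 * s) rfl y) y ≠ 0) →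
      ∀ (x : complexBetti X (2 * p)),
      complexBetti.map f (2 * p) x ∈ Submodule.span ℂ
        {r : complexBetti Y (2 * p) | IsRationalClass r ∧ IsOfHodgeType m Y (2 * p) p p r} →
      lefschetzPowTo (complexBetti.map f 2 κ) (s + 1) (2 * p) (2 * p + 2 * (s + 1)) rfl
        (complexBetti.map f (2 * p) x) = 0 →
      (∀ y : complexBetti X k,
        cupProduct hk (complexBetti.map f (2 * p) x) (complexBetti.map f k y) = 0) →
      complexBetti.map f (2 * p) x = 0 := by
  intro n m p s k X Y f hX hY hs hk κ hκ hHR x hxspan hprim horth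
  classical
  obtain ⟨A⟩ := nonempty_hodgeModel_holds (n := m) (X := Y) hY
  have h2m : 2 * p + 2 * s + 2 * p = 2 * m := by omega
  have hk2 : 2 * p + 2 * s = k := by omega
  -- the class `P` of rational primitive `(p,p)`-classes and the form `Q(u, v) = λ_ℂ(Lˢ u ∪ v)`
  obtain ⟨P, hP⟩ : ∃ P : complexBetti Y (2 * p) → Prop, ∀ v, P v ↔
      IsRationalClass v ∧ IsOfHodgeType m Y (2 * p) p p v ∧
        lefschetzPowTo (complexBetti.map f 2 κ) (s + 1) (2 * p) (2 * p + 2 * (s + 1)) rfl v = 0 :=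
    ⟨_, fun v ↦ Iff.rfl⟩
  obtain ⟨Q, hQ⟩ : ∃ Q : complexBetti Y (2 * p) →ₗ[ℂ] complexBetti Y (2 * p) →ₗ[ℂ] ℂ, ∀ u v,
      Q u v = cTopCoord hY (cupProduct h2m
        (lefschetzPowTo (complexBetti.map f 2 κ) s (2 * p) (2 * p + 2 * s) rfl u) v) :=
    ⟨LinearMap.compr₂ ((cupProduct h2m).comp
      (lefschetzPowTo (complexBetti.map f 2 κ) s (2 * p) (2 * p + 2 * s) rfl)) (cTopCoord hY),
      fun u v ↦ rfl⟩
  -- `f^* x = Σ_l t_l r_l` with `r_l` rational, `(p,p)`, primitive and restricted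
  obtain ⟨N, t, r', hx'⟩ := Submodule.mem_span_set'.1
    (complexBetti_map_mem_span_primitive_restricted f hX hY A κ hκ x hxspan hprim)
  rw [← hx']
  refine sum_smul_eq_zero_of_forall_apply_eq_zero Q P ?_ ?_ ?_ (fun l ↦ (hP _).2 (r' l).2.1) t ?_
  · -- `P` is closed under rational combinations
    intro N q r hr
    refine (hP _).2 ⟨IsRationalClass.sum_smul _ (fun l ↦ ((hP _).1 (hr l)).1) q,
      IsOfHodgeType.sum hY A _ _ fun l _ ↦ ((hP _).1 (hr l)).2.1.smul _, ?_⟩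
    rw [map_sum]
    exact Finset.sum_eq_zero fun l _ ↦ by rw [map_smul, ((hP _).1 (hr l)).2.2, smul_zero]
  · -- `Q` is rational on `P`
    intro u v hu hv
    rw [hQ]
    exact exists_cTopCoord_eq_ratCast hY
      ((hκ.lefschetzPowTo s (2 * p) _ rfl ((hP u).1 hu).1).cup h2m ((hP v).1 hv).1)
  · -- `Q` is anisotropic on `P`: the Hodge–Riemann hypothesis
    intro v hv hQv
    obtain ⟨hv₁, hv₂, hv₃⟩ := (hP v).1 hv
    by_contra hv0
    rw [hQ] at hQv
    exact hHR v hv₁ hv₂ hv₃ hv0 (eq_zero_of_cTopCoord_eq_zero hY hQv)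
  · -- `f^* x` is `Q`-orthogonal to the restricted classes `r_l`
    intro l'
    obtain ⟨u, hu⟩ := (r' l').2.2
    rw [hQ, hx', ← hu, cupProduct_lefschetzPowTo_map_eq_zero f κ h2m hk hk2 _ horth u, map_zero]

end Summit.HodgeConjecture.HodgeConjecture.Theorems

end
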